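import Mathlib
import HarnessLib
import Literature.Computability.AlgebraicComplexity.AsymptoticSpectrum
import Literature.Computability.AlgebraicComplexity.BILPS19MinrankVarieties
import Literature.Barriers.Schanuel.AlgebraicIndependenceOfLogarithmsStructuralRankProofs

/-!
# OutsiderSandwich — pencil calculus for powers of the diagonalised Coppersmith–Winograd tensor, I: blocks
(decomp-mm lens 4 «minimal-counterexample / extremal reduction», gen 38, kernel K38-2a; THESES-FREE and
DEFINITION-FREE: the tensor is carried as a hypothesis `hD`)

Over `ℂ` the little Coppersmith–Winograd tensor `cw₂ = x₀(y₁z₁+y₂z₂) + x₁(y₀z₁+y₁z₀) + x₂(y₀z₂+y₂z₀)` is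
isomorphic (substitute `u_± = u₁ ± i u₂` in all three factors) to the *diagonalised* tensor
`D = ∑_{ {a,b,c} = {0,1,2} } x_a ⊗ y_b ⊗ z_c`, i.e. `D a b c = [a, b, c pairwise distinct]` on `Fin 3`.
Throughout, `D` is ANY tensor satisfying `hD : ∀ a b c, D a b c = if a ≠ b ∧ b ≠ c ∧ a ≠ c then 1 else 0`
(there is exactly one; no definition is introduced),
`T_N(η) = contract3 (kroneckerPow D N) η` is the slice of `D^{⊠N}` at the covector `η` (BILPS contraction)
and `η_a = fun v ↦ η (Fin.cons a v)` is the `a`-th first-letter component of `η`.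

Splitting off the first letter writes `T_{N+1}(η)` as the symmetric `3 × 3` block matrix
`[[0, M₂, M₁], [M₂, 0, M₀], [M₁, M₀, 0]]`, `M_a = T_N(η_a)` (`slice_succ_split` / `slice_succ_offdiag` /
`slice_succ_diag`: the `(b,c)` block is `T_N(η_a)` for `{a,b,c} = {0,1,2}`, the diagonal blocks vanish).  Proved here:

* `two_mul_rank_block_le` / `two_mul_rank_comp_le` — `rank T_{N+1}(η) ≥ 2 · rank T_N(η_a)` for every
  letter `a` (Roy's block-triangular rank inequality, tree lemma
  `Literature.Barriers.Schanuel.rank_submatrix_add_rank_submatrix_le`, applied to the blocks `(b,c)`, `(c,b)`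
  against the zero block `(b,b)`);
* `two_pow_le_rank_slice` — every non-zero slice of `D^{⊠N}` has rank `≥ 2^N`;
* `three_mul_rank_le_of_prod` — a PRODUCT covector `(λ ⊗ ζ)(f) = λ(f 0) ζ(tail f)` with `λ₀λ₁λ₂ ≠ 0`
  has `rank T_{N+1}(λ ⊗ ζ) ≥ 3 · rank T_N(ζ)` (`T_{N+1}(λ ⊗ ζ) = D(λ) ⊗ T_N(ζ)` with
  `D(λ) = [[0,λ₂,λ₁],[λ₂,0,λ₀],[λ₁,λ₀,0]]` invertible: explicit adjugate, `det D(λ) = 2λ₀λ₁λ₂`);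
* `slice_succ_mulVec_block` — the action of `T_{N+1}(η)` on a vector supported on one block.

Part II (`OutsiderSandwichPencilSpan`) proves the pencil laws, Part III transports them to packings
`⟨B⟩ ⊗ ⟨m,m,m⟩ ≤ cw₂^{⊠N}`.

References: [cite: CoppersmithWinograd1990, §6]; [cite: BlaserIkenmeyerLysikovPandeySchreyer2019, §5, Def. 13];
[cite: Roy1995, §1]; [cite: HornJohnson2013, §0.4].
-/

set_option linter.dupNamespace false

noncomputable section

namespace Summit.MatrixMultiplication.MatrixMultiplication.Theorems.OutsiderSandwichPencilBlocks

open Literature.Computability.AlgebraicComplexity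
open scoped Matrix BigOperators

variable {D : Fin 3 → Fin 3 → Fin 3 → ℂ} {N : ℕ}

/-! ## §0  Letter combinatorics in `Fin 3` -/

/-- In `Fin 3`, a letter different from two distinct letters `b, c` is the third one. [folklore] -/
theorem letter_eq_or (a a' b c : Fin 3) (hab : a ≠ b) (hbc : b ≠ c) (hac : a ≠ c) (ha' : a' ≠ a) :
    a' = b ∨ a' = c := by
  revert a a' b c; decide

/-- The letters `a + 1`, `a + 2` are distinct and distinct from `a`. [folklore] -/
theorem succ_letters (a : Fin 3) : a ≠ a + 1 ∧ a + 1 ≠ a + 2 ∧ a ≠ a + 2 := by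
  revert a; decide

/-! ## §1  Slices of `D^{⊠N}`: entries, linearity, symmetry -/

/-- `D` is symmetric in its last two legs. [cite: CoppersmithWinograd1990, §6] -/
theorem d_symm (hD : ∀ a b c, D a b c = if a ≠ b ∧ b ≠ c ∧ a ≠ c then 1 else 0) (a b c : Fin 3) :
    D a b c = D a c b := by
  rw [hD, hD]
  by_cases h1 : a = b <;> by_cases h2 : b = c <;> by_cases h3 : a = c <;> simp_all [eq_comm]

/-- The value of `D` at a pairwise distinct triple. [cite: CoppersmithWinograd1990, §6] -/
theorem d_offdiag (hD : ∀ a b c, D a b c = if a ≠ b ∧ b ≠ c ∧ a ≠ c then 1 else 0) {a b c : Fin 3}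
    (hab : a ≠ b) (hbc : b ≠ c) (hac : a ≠ c) : D a b c = 1 := by
  rw [hD]; simp [hab, hbc, hac]

/-- `D` vanishes on the diagonal `b = c`. [cite: CoppersmithWinograd1990, §6] -/
theorem d_diag (hD : ∀ a b c, D a b c = if a ≠ b ∧ b ≠ c ∧ a ≠ c then 1 else 0) (a b : Fin 3) :
    D a b b = 0 := by
  rw [hD]; simp

/-- `D a b c` vanishes unless `a` is the third letter. [cite: CoppersmithWinograd1990, §6] -/
theorem d_eq_zero_of_ne (hD : ∀ a b c, D a b c = if a ≠ b ∧ b ≠ c ∧ a ≠ c then 1 else 0) {a a' b c : Fin 3}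
    (hab : a ≠ b) (hbc : b ≠ c) (hac : a ≠ c) (ha' : a' ≠ a) : D a' b c = 0 := by
  rw [hD]
  rcases letter_eq_or a a' b c hab hbc hac ha' with h | h <;> simp [h]

/-- Entries of a slice of `D^{⊠N}`. [cite: BlaserIkenmeyerLysikovPandeySchreyer2019, §5] -/
theorem slice_apply (N : ℕ) (η : (Fin N → Fin 3) → ℂ) (w w' : Fin N → Fin 3) :
    contract3 (kroneckerPow D N) η w w' = ∑ f : Fin N → Fin 3, η f * ∏ i, D (f i) (w i) (w' i) := by
  simp [contract3_apply, kroneckerPow_apply]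

/-- Slices are additive in the covector. [folklore] -/
theorem slice_add {ι κ μ : Type*} [Fintype ι] (t : ι → κ → μ → ℂ) (η η' : ι → ℂ) :
    contract3 t (η + η') = contract3 t η + contract3 t η' := by
  ext b c
  simp [contract3_apply, Matrix.add_apply, add_mul, Finset.sum_add_distrib]

/-- Slices are homogeneous in the covector. [folklore] -/
theorem slice_smul {ι κ μ : Type*} [Fintype ι] (t : ι → κ → μ → ℂ) (c : ℂ) (η : ι → ℂ) :
    contract3 t (c • η) = c • contract3 t η := by
  ext b c'
  simp [contract3_apply, Matrix.smul_apply, Finset.mul_sum, mul_assoc]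

/-- The slice at the zero covector vanishes. [folklore] -/
theorem slice_zero {ι κ μ : Type*} [Fintype ι] (t : ι → κ → μ → ℂ) : contract3 t (0 : ι → ℂ) = 0 := by
  ext b c; simp [contract3_apply]

/-- Slices of `D^{⊠N}` are symmetric matrices. [folklore] -/
theorem slice_transpose (hD : ∀ a b c, D a b c = if a ≠ b ∧ b ≠ c ∧ a ≠ c then 1 else 0) (N : ℕ)
    (η : (Fin N → Fin 3) → ℂ) : (contract3 (kroneckerPow D N) η)ᵀ = contract3 (kroneckerPow D N) η := by
  ext w w'
  simp only [Matrix.transpose_apply, slice_apply]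
  refine Finset.sum_congr rfl fun f _ => ?_
  congr 1
  exact Finset.prod_congr rfl fun i _ => d_symm hD _ _ _

/-- A covector on words of length `N + 1` vanishes iff all its first-letter components do. [folklore] -/
theorem eq_zero_of_comp_eq_zero {η : (Fin (N + 1) → Fin 3) → ℂ}
    (h : ∀ a : Fin 3, (fun v : Fin N → Fin 3 => η (Fin.cons a v)) = 0) : η = 0 := by
  funext f
  have := congr_fun (h (f 0)) (Fin.tail f)
  simpa using this

/-! ## §2  Splitting off the first letter -/

/-- **First-letter splitting of a slice** (no hypothesis on `D`): the entry of `T_{N+1}(η)` at row `b :: w`,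
column `c :: w'` is `∑ₐ D(a,b,c) · T_N(η_a)(w, w')`. [cite: CoppersmithWinograd1990, §6] -/
theorem slice_succ_split (N : ℕ) (η : (Fin (N + 1) → Fin 3) → ℂ) (b c : Fin 3) (w w' : Fin N → Fin 3) :
    contract3 (kroneckerPow D (N + 1)) η (Fin.cons b w) (Fin.cons c w') =
      ∑ a : Fin 3, D a b c * contract3 (kroneckerPow D N) (fun v => η (Fin.cons a v)) w w' := by
  rw [slice_apply]
  let e : Fin 3 × (Fin N → Fin 3) ≃ (Fin (N + 1) → Fin 3) := Fin.consEquiv fun _ => Fin 3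
  have he : ∀ p : Fin 3 × (Fin N → Fin 3), e p = Fin.cons p.1 p.2 := fun _ => rfl
  have hsplit : ∀ f : Fin (N + 1) → Fin 3,
      η f * ∏ i, D (f i) ((Fin.cons b w : Fin (N + 1) → Fin 3) i) ((Fin.cons c w' : Fin (N + 1) → Fin 3) i)
        = η f * (D (f 0) b c * ∏ i : Fin N, D (f i.succ) (w i) (w' i)) := by
    intro f
    rw [Fin.prod_univ_succ]
    simp
  simp_rw [hsplit]
  rw [← e.sum_comp, Fintype.sum_prod_type]
  simp only [he, Fin.cons_zero, Fin.cons_succ]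
  refine Finset.sum_congr rfl fun a _ => ?_
  rw [slice_apply, Finset.mul_sum]
  refine Finset.sum_congr rfl fun g _ => ?_
  ring

/-- The diagonal blocks of `T_{N+1}(η)` vanish. [cite: CoppersmithWinograd1990, §6] -/
theorem slice_succ_diag (hD : ∀ a b c, D a b c = if a ≠ b ∧ b ≠ c ∧ a ≠ c then 1 else 0) (N : ℕ)
    (η : (Fin (N + 1) → Fin 3) → ℂ) (b : Fin 3) (w w' : Fin N → Fin 3) :
    contract3 (kroneckerPow D (N + 1)) η (Fin.cons b w) (Fin.cons b w') = 0 := by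
  rw [slice_succ_split]
  simp [d_diag hD]

/-- The off-diagonal block `(b, c)` of `T_{N+1}(η)` is `T_N(η_a)`, `{a,b,c} = {0,1,2}`.
[cite: CoppersmithWinograd1990, §6] -/
theorem slice_succ_offdiag (hD : ∀ a b c, D a b c = if a ≠ b ∧ b ≠ c ∧ a ≠ c then 1 else 0) (N : ℕ)
    (η : (Fin (N + 1) → Fin 3) → ℂ) {a b c : Fin 3} (hab : a ≠ b) (hbc : b ≠ c) (hac : a ≠ c)
    (w w' : Fin N → Fin 3) :
    contract3 (kroneckerPow D (N + 1)) η (Fin.cons b w) (Fin.cons c w') =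
      contract3 (kroneckerPow D N) (fun v => η (Fin.cons a v)) w w' := by
  rw [slice_succ_split, Finset.sum_eq_single a]
  · rw [d_offdiag hD hab hbc hac, one_mul]
  · intro a' _ ha'
    rw [d_eq_zero_of_ne hD hab hbc hac ha', zero_mul]
  · simp

/-- The off-diagonal block as a submatrix. [folklore] -/
theorem slice_succ_submatrix_block (hD : ∀ a b c, D a b c = if a ≠ b ∧ b ≠ c ∧ a ≠ c then 1 else 0)
    (N : ℕ) (η : (Fin (N + 1) → Fin 3) → ℂ) {a b c : Fin 3} (hab : a ≠ b) (hbc : b ≠ c) (hac : a ≠ c) :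
    (contract3 (kroneckerPow D (N + 1)) η).submatrix
        (fun w : Fin N → Fin 3 => (Fin.cons b w : Fin (N + 1) → Fin 3))
        (fun w' : Fin N → Fin 3 => (Fin.cons c w' : Fin (N + 1) → Fin 3)) =
      contract3 (kroneckerPow D N) (fun v => η (Fin.cons a v)) := by
  ext w w'
  rw [Matrix.submatrix_apply, slice_succ_offdiag hD N η hab hbc hac]

/-- **Action on a block vector, off-diagonal block**: for the vector `x^{(c)}` supported on the block `c`
(`x^{(c)}(c :: v) = x v`, zero elsewhere) and `{a,b,c} = {0,1,2}`, the block `b` of `T_{N+1}(η) x^{(c)}`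
is `T_N(η_a) x`. [folklore] -/
theorem slice_succ_mulVec_block (hD : ∀ a b c, D a b c = if a ≠ b ∧ b ≠ c ∧ a ≠ c then 1 else 0) (N : ℕ)
    (η : (Fin (N + 1) → Fin 3) → ℂ) {a b c : Fin 3} (hab : a ≠ b) (hbc : b ≠ c) (hac : a ≠ c)
    (x : (Fin N → Fin 3) → ℂ) (w : Fin N → Fin 3) :
    (contract3 (kroneckerPow D (N + 1)) η *ᵥ
        (fun g : Fin (N + 1) → Fin 3 => if g 0 = c then x (Fin.tail g) else 0)) (Fin.cons b w) =
      (contract3 (kroneckerPow D N) (fun v => η (Fin.cons a v)) *ᵥ x) w := by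
  let e : Fin 3 × (Fin N → Fin 3) ≃ (Fin (N + 1) → Fin 3) := Fin.consEquiv fun _ => Fin 3
  have he : ∀ p : Fin 3 × (Fin N → Fin 3), e p = Fin.cons p.1 p.2 := fun _ => rfl
  simp only [Matrix.mulVec, dotProduct]
  rw [← e.sum_comp, Fintype.sum_prod_type, Finset.sum_eq_single c]
  · refine Finset.sum_congr rfl fun v _ => ?_
    simp only [he, Fin.cons_zero, Fin.tail_cons, if_true]
    rw [slice_succ_offdiag hD N η hab hbc hac]
  · intro c' _ hc'
    refine Finset.sum_eq_zero fun v _ => ?_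
    simp only [he, Fin.cons_zero, hc', if_false, mul_zero]
  · simp

/-- **Action on a block vector, diagonal block**: the block `c` of `T_{N+1}(η) x^{(c)}` vanishes. [folklore] -/
theorem slice_succ_mulVec_block_diag (hD : ∀ a b c, D a b c = if a ≠ b ∧ b ≠ c ∧ a ≠ c then 1 else 0)
    (N : ℕ) (η : (Fin (N + 1) → Fin 3) → ℂ) (c : Fin 3) (x : (Fin N → Fin 3) → ℂ) (w : Fin N → Fin 3) :
    (contract3 (kroneckerPow D (N + 1)) η *ᵥ
        (fun g : Fin (N + 1) → Fin 3 => if g 0 = c then x (Fin.tail g) else 0)) (Fin.cons c w) = 0 := by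
  let e : Fin 3 × (Fin N → Fin 3) ≃ (Fin (N + 1) → Fin 3) := Fin.consEquiv fun _ => Fin 3
  have he : ∀ p : Fin 3 × (Fin N → Fin 3), e p = Fin.cons p.1 p.2 := fun _ => rfl
  simp only [Matrix.mulVec, dotProduct]
  rw [← e.sum_comp, Fintype.sum_prod_type]
  refine Finset.sum_eq_zero fun c' _ => Finset.sum_eq_zero fun v _ => ?_
  by_cases hc' : c' = c
  · subst hc'
    simp only [he]
    rw [slice_succ_diag hD, zero_mul]
  · simp only [he, Fin.cons_zero, hc', if_false, mul_zero]

/-! ## §3  Rank of the slice versus ranks of the blocks -/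

/-- **Twice a block.**  For `{a,b,c} = {0,1,2}`, `rank T_{N+1}(η) ≥ 2 · rank T_N(η_a)`: the diagonal block
`(b,b)` vanishes, so Roy's block-triangular inequality applies to the blocks `(b,c)` and `(c,b)`.
[cite: Roy1995, §1] -/
theorem two_mul_rank_block_le (hD : ∀ a b c, D a b c = if a ≠ b ∧ b ≠ c ∧ a ≠ c then 1 else 0) (N : ℕ)
    (η : (Fin (N + 1) → Fin 3) → ℂ) {a b c : Fin 3} (hab : a ≠ b) (hbc : b ≠ c) (hac : a ≠ c) :
    2 * (contract3 (kroneckerPow D N) (fun v => η (Fin.cons a v))).rank ≤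
      (contract3 (kroneckerPow D (N + 1)) η).rank := by
  have h := Literature.Barriers.Schanuel.rank_submatrix_add_rank_submatrix_le
    (contract3 (kroneckerPow D (N + 1)) η)
    (fun w : Fin N → Fin 3 => (Fin.cons b w : Fin (N + 1) → Fin 3))
    (fun w' : Fin N → Fin 3 => (Fin.cons c w' : Fin (N + 1) → Fin 3))
    (fun w : Fin N → Fin 3 => (Fin.cons c w : Fin (N + 1) → Fin 3))
    (fun w' : Fin N → Fin 3 => (Fin.cons b w' : Fin (N + 1) → Fin 3))
    (fun i j => slice_succ_diag hD N η b i j)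
  rw [slice_succ_submatrix_block hD N η hab hbc hac,
    slice_succ_submatrix_block hD N η hac (Ne.symm hbc) hab] at h
  omega

/-- Twice the block attached to ANY letter `a`. [cite: Roy1995, §1] -/
theorem two_mul_rank_comp_le (hD : ∀ a b c, D a b c = if a ≠ b ∧ b ≠ c ∧ a ≠ c then 1 else 0) (N : ℕ)
    (η : (Fin (N + 1) → Fin 3) → ℂ) (a : Fin 3) :
    2 * (contract3 (kroneckerPow D N) (fun v => η (Fin.cons a v))).rank ≤
      (contract3 (kroneckerPow D (N + 1)) η).rank := by
  obtain ⟨hab, hbc, hac⟩ := succ_letters a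
  exact two_mul_rank_block_le hD N η hab hbc hac

/-- Base of the induction: a non-zero slice of `D^{⊠0}` (a `1 × 1` matrix) has rank `1`. [folklore] -/
theorem rank_slice_zero {η : (Fin 0 → Fin 3) → ℂ} (hη : η ≠ 0) : (contract3 (kroneckerPow D 0) η).rank = 1 := by
  have hval : η default ≠ 0 := by
    intro h; apply hη; funext f; rw [Subsingleton.elim f default]; exact h
  have hM : contract3 (kroneckerPow D 0) η = Matrix.of fun _ _ => η default := by
    ext w w'
    rw [slice_apply, Fintype.sum_unique]
    simp only [Finset.univ_eq_empty, Finset.prod_empty, mul_one, Matrix.of_apply]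
    exact congr_arg η (Subsingleton.elim _ _)
  have hdet : IsUnit (contract3 (kroneckerPow D 0) η).det := by
    rw [hM, Matrix.det_unique]
    exact isUnit_iff_ne_zero.mpr hval
  rw [Matrix.rank_of_isUnit _ ((Matrix.isUnit_iff_isUnit_det _).mpr hdet)]
  simp

/-- **Minrank gap for `D`**: every non-zero slice of `D^{⊠N}` has rank `≥ 2^N`.
[cite: CoppersmithWinograd1990, §6] [cite: BlaserIkenmeyerLysikovPandeySchreyer2019, Def. 13] -/
theorem two_pow_le_rank_slice (hD : ∀ a b c, D a b c = if a ≠ b ∧ b ≠ c ∧ a ≠ c then 1 else 0) :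
    ∀ (N : ℕ) {η : (Fin N → Fin 3) → ℂ}, η ≠ 0 → 2 ^ N ≤ (contract3 (kroneckerPow D N) η).rank := by
  intro N
  induction N with
  | zero => intro η hη; rw [rank_slice_zero hη]; simp
  | succ N ih =>
    intro η hη
    obtain ⟨a, ha⟩ : ∃ a : Fin 3, (fun v : Fin N → Fin 3 => η (Fin.cons a v)) ≠ 0 := by
      by_contra h
      push Not at h
      exact hη (eq_zero_of_comp_eq_zero h)
    calc 2 ^ (N + 1) = 2 * 2 ^ N := by ring
      _ ≤ 2 * (contract3 (kroneckerPow D N) (fun v => η (Fin.cons a v))).rank :=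
          Nat.mul_le_mul_left 2 (ih ha)
      _ ≤ (contract3 (kroneckerPow D (N + 1)) η).rank := two_mul_rank_comp_le hD N η a

/-! ## §4  Product covectors `λ ⊗ ζ` -/

/-- `rank (1₃ ⊗ M) ≥ 3 · rank M` (two applications of the block-triangular inequality). [cite: Roy1995, §1] -/
theorem three_mul_rank_le_rank_blockDiag {X : Type*} [Fintype X] [DecidableEq X] (M : Matrix X X ℂ) :
    3 * M.rank ≤ (Matrix.of fun p q : Fin 3 × X => if p.1 = q.1 then M p.2 q.2 else 0).rank := by
  set Δ : Matrix (Fin 3 × X) (Fin 3 × X) ℂ := Matrix.of fun p q => if p.1 = q.1 then M p.2 q.2 else 0 with hΔ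
  have h1 := Literature.Barriers.Schanuel.rank_submatrix_add_rank_submatrix_le Δ
    (fun w : X => ((0 : Fin 3), w)) (fun w' : X => ((0 : Fin 3), w'))
    (fun p : Fin 2 × X => (Fin.succ p.1, p.2)) (fun q : Fin 2 × X => (Fin.succ q.1, q.2))
    (fun i j => by simp [hΔ, (Fin.succ_ne_zero j.1).symm])
  have hA : Δ.submatrix (fun w : X => ((0 : Fin 3), w)) (fun w' : X => ((0 : Fin 3), w')) = M := by
    ext w w'; simp [hΔ]
  set B := Δ.submatrix (fun p : Fin 2 × X => (Fin.succ p.1, p.2)) (fun q : Fin 2 × X => (Fin.succ q.1, q.2))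
    with hB
  have hBapply : ∀ p q : Fin 2 × X, B p q = if p.1 = q.1 then M p.2 q.2 else 0 := by
    intro p q; simp [hB, hΔ, Fin.succ_inj]
  have h2 := Literature.Barriers.Schanuel.rank_submatrix_add_rank_submatrix_le B
    (fun w : X => ((0 : Fin 2), w)) (fun w' : X => ((0 : Fin 2), w'))
    (fun w : X => ((1 : Fin 2), w)) (fun w' : X => ((1 : Fin 2), w'))
    (fun i j => by rw [hBapply]; simp)
  have hB0 : B.submatrix (fun w : X => ((0 : Fin 2), w)) (fun w' : X => ((0 : Fin 2), w')) = M := by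
    ext w w'; simp [hBapply]
  have hB1 : B.submatrix (fun w : X => ((1 : Fin 2), w)) (fun w' : X => ((1 : Fin 2), w')) = M := by
    ext w w'; simp [hBapply]
  rw [hA] at h1
  rw [hB0, hB1] at h2
  omega

/-- **Product covectors.**  If `λ₀λ₁λ₂ ≠ 0`, then `rank T_{N+1}(λ ⊗ ζ) ≥ 3 · rank T_N(ζ)`:
`T_{N+1}(λ ⊗ ζ) = D(λ) ⊗ T_N(ζ)` and `D(λ) · adj D(λ) = 2λ₀λ₁λ₂ · 1`. [cite: CoppersmithWinograd1990, §6]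
[cite: HornJohnson2013, §0.4] -/
theorem three_mul_rank_le_of_prod (hD : ∀ a b c, D a b c = if a ≠ b ∧ b ≠ c ∧ a ≠ c then 1 else 0)
    (lam : Fin 3 → ℂ) (hlam : ∀ a, lam a ≠ 0) (ζ : (Fin N → Fin 3) → ℂ) :
    3 * (contract3 (kroneckerPow D N) ζ).rank ≤
      (contract3 (kroneckerPow D (N + 1)) (fun f => lam (f 0) * ζ (Fin.tail f))).rank := by
  classical
  let e : Fin 3 × (Fin N → Fin 3) ≃ (Fin (N + 1) → Fin 3) := Fin.consEquiv fun _ => Fin 3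
  have he : ∀ p : Fin 3 × (Fin N → Fin 3), e p = Fin.cons p.1 p.2 := fun _ => rfl
  set M := contract3 (kroneckerPow D N) ζ with hM
  set Φ := (contract3 (kroneckerPow D (N + 1)) (fun f => lam (f 0) * ζ (Fin.tail f))).submatrix e e with hΦ
  -- `dl = D(λ)`, the slice of `D` itself at `λ`, and its adjugate up to the scalar `s = 2λ₀λ₁λ₂`
  set dl : Matrix (Fin 3) (Fin 3) ℂ := contract3 D lam with hdl
  let adj : Matrix (Fin 3) (Fin 3) ℂ :=
    !![-(lam 0 * lam 0), lam 0 * lam 1, lam 0 * lam 2;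
       lam 0 * lam 1, -(lam 1 * lam 1), lam 1 * lam 2;
       lam 0 * lam 2, lam 1 * lam 2, -(lam 2 * lam 2)]
  set s : ℂ := 2 * (lam 0 * lam 1 * lam 2) with hs
  have hs0 : s ≠ 0 :=
    mul_ne_zero two_ne_zero (mul_ne_zero (mul_ne_zero (hlam 0) (hlam 1)) (hlam 2))
  have hinv : dl * adj = s • (1 : Matrix (Fin 3) (Fin 3) ℂ) := by
    ext i j
    fin_cases i <;> fin_cases j <;>
      simp [hdl, contract3_apply, adj, Matrix.mul_apply, Fin.sum_univ_three, hD, hs] <;> ring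
  have hcomp : ∀ a : Fin 3, (fun v : Fin N → Fin 3 =>
      (fun f : Fin (N + 1) → Fin 3 => lam (f 0) * ζ (Fin.tail f)) (Fin.cons a v)) = lam a • ζ := by
    intro a; funext v; simp
  have hΦapply : ∀ p q : Fin 3 × (Fin N → Fin 3), Φ p q = dl p.1 q.1 * M p.2 q.2 := by
    rintro ⟨b, w⟩ ⟨c, w'⟩
    rw [hΦ, Matrix.submatrix_apply, he, he]
    rw [slice_succ_split, hdl, contract3_apply, Finset.sum_mul]
    refine Finset.sum_congr rfl fun a _ => ?_
    rw [hcomp a, slice_smul, Matrix.smul_apply, smul_eq_mul, hM]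
    ring
  let Y : Matrix (Fin 3 × (Fin N → Fin 3)) (Fin 3 × (Fin N → Fin 3)) ℂ :=
    Matrix.of fun q r => s⁻¹ * adj q.1 r.1 * (if q.2 = r.2 then 1 else 0)
  have hprod : Φ * Y = Matrix.of fun p q : Fin 3 × (Fin N → Fin 3) => if p.1 = q.1 then M p.2 q.2 else 0 := by
    ext p r
    simp only [Matrix.mul_apply, hΦapply, Matrix.of_apply, Y]
    rw [Fintype.sum_prod_type]
    have hrow : ∀ c : Fin 3, ∑ w' : Fin N → Fin 3,
        dl p.1 c * M p.2 w' * (s⁻¹ * adj c r.1 * if w' = r.2 then 1 else 0) =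
          s⁻¹ * (dl p.1 c * adj c r.1) * M p.2 r.2 := by
      intro c
      simp_rw [mul_ite, mul_one, mul_zero]
      rw [Finset.sum_ite_eq' Finset.univ r.2]
      simp only [Finset.mem_univ, if_true]
      ring
    simp_rw [hrow]
    rw [← Finset.sum_mul, ← Finset.mul_sum]
    have hid : ∑ c : Fin 3, dl p.1 c * adj c r.1 = (dl * adj) p.1 r.1 := by rw [Matrix.mul_apply]
    rw [hid, hinv]
    simp only [Matrix.smul_apply, Matrix.one_apply, smul_eq_mul]
    by_cases hpr : p.1 = r.1
    · simp only [hpr, if_true, mul_one]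
      rw [inv_mul_cancel₀ hs0, one_mul]
    · simp [hpr]
  calc 3 * M.rank ≤ (Matrix.of fun p q : Fin 3 × (Fin N → Fin 3) => if p.1 = q.1 then M p.2 q.2 else 0).rank :=
        three_mul_rank_le_rank_blockDiag M
    _ = (Φ * Y).rank := by rw [hprod]
    _ ≤ Φ.rank := Matrix.rank_mul_le_left _ _
    _ = _ := by rw [hΦ, Matrix.rank_submatrix]

end Summit.MatrixMultiplication.MatrixMultiplication.Theorems.OutsiderSandwichPencilBlocks
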